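import Mathlib
import HarnessLib

/-!
# Crux `HypALocalTwoPoint`, line `gnv` — bounded second differences: the quadrilateral estimate,
# composition, and fixed points of parametrised contractions

Route `route-HubbardSuperconductivity-ComplexGFFStiffness`, crux item stmt-HubbardSuperconductivity-19155,
census entries (C3a)/(C3b) of the reduction of `stub_twoPointGivenZ` to `OnePointLipschitz`
(`N`-uniform bounded second differences of the finite-volume free energy along the tuned
renormalisation-group flow).  Elementary calculus of maps between normed groups that are LIPSCHITZ and have BOUNDED SECOND
DIFFERENCES on a ball — `‖g(a+u+v) − g(a+u) − g(a+v) + g(a)‖ ≤ C‖u‖‖v‖` ("`C^{1,1}` without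
derivatives").  This is the regularity that smoothness arguments for renormalisation-group flows
actually consume when only estimates on DIFFERENCES are available (e.g. the fine-tuning theorems of
`Literature/Dynamics/Hyperbolic/RGFlowStableManifold*.lean`, which are run on differences of
trajectories): a bound on mixed second differences of a free energy along a two-parameter family
bounds the difference of its first derivatives, and the class is closed under the operations below.

* `norm_secondDiff_quad_le` — the QUADRILATERAL estimate: over four points `a₀₀, a₁₀, a₀₁, a₁₁` that
  need not form a parallelogram,
  `‖g a₁₁ − g a₁₀ − g a₀₁ + g a₀₀‖ ≤ L‖a₁₁ − a₁₀ − a₀₁ + a₀₀‖ + C‖a₁₀ − a₀₀‖‖a₀₁ − a₀₀‖`;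
* `norm_secondDiff_comp_le` — COMPOSITION: `g ∘ f` has second differences bounded by
  `(L_g C_f + C_g L_f²)‖u‖‖v‖`;
* `norm_fixedPoint_sub_le`, `norm_secondDiff_fixedPoint_le` — FIXED POINTS OF PARAMETRISED
  CONTRACTIONS `h(p) = Φ(p, h(p))` (`Φ(p,·)` a `θ`-contraction): `p ↦ h(p)` is Lipschitz with
  constant `L/(1−θ)` and has second differences bounded by `C(1 + L/(1−θ))²/(1−θ)·‖u‖‖v‖` when `Φ`
  has joint second differences `≤ C(‖u‖+‖y‖)(‖v‖+‖z‖)` — the difference-calculus form of the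
  `C^{1,1}` implicit function theorem (as needed for the second fixed point of [ABKM19] Lemma 12.6
  with regular dependence on the perturbation).

Everything is proved; no named fact.  Radii: hypotheses on the `R`-ball, points in the `R/3`-ball
(the auxiliary vertex `a₁₀ + a₀₁ − a₀₀` of the quadrilateral estimate has norm `≤ R`).

## References
* S. Adams, S. Buchholz, R. Kotecký, S. Müller, arXiv:1910.13564, Ch. 12 (Thm 12.1, Lemma 12.6:
  the fine-tuning fixed points whose regular dependence on the data is used in Thm 2.2)
  [AdamsBuchholzKoteckyMuller2019].
-/

noncomputable section

-- `Summit.<Summit>.<Problem>`: single-conjunct summit, the duplicate component is mandated (D-0017).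
set_option linter.dupNamespace false

namespace Summit.HubbardSuperconductivity.HubbardSuperconductivity.Theorems.ComplexGFF

variable {E F G : Type*} [NormedAddCommGroup E] [NormedAddCommGroup F] [NormedAddCommGroup G]

/-! ## The quadrilateral estimate -/

/-- **Quadrilateral estimate.** If `g` is `L`-Lipschitz on the `R`-ball and has parallelogram
second differences `≤ C‖u‖‖v‖` there, then over ANY four points `a₀₀, a₁₀, a₀₁` (norm `≤ R/3`) and
`a₁₁` (norm `≤ R`):
`‖g a₁₁ − g a₁₀ − g a₀₁ + g a₀₀‖ ≤ L·‖a₁₁ − a₁₀ − a₀₁ + a₀₀‖ + C·‖a₁₀ − a₀₀‖·‖a₀₁ − a₀₀‖`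
(compare `a₁₁` with the fourth vertex `a₁₀ + a₀₁ − a₀₀` of the parallelogram). -/
theorem norm_secondDiff_quad_le {g : F → G} {R L C : ℝ}
    (hL : ∀ a b : F, ‖a‖ ≤ R → ‖b‖ ≤ R → ‖g a - g b‖ ≤ L * ‖a - b‖)
    (hC : ∀ a u v : F, ‖a‖ ≤ R → ‖a + u‖ ≤ R → ‖a + v‖ ≤ R → ‖a + u + v‖ ≤ R →
      ‖g (a + u + v) - g (a + u) - g (a + v) + g a‖ ≤ C * ‖u‖ * ‖v‖)
    {a₀₀ a₁₀ a₀₁ a₁₁ : F} (h₀₀ : ‖a₀₀‖ ≤ R / 3) (h₁₀ : ‖a₁₀‖ ≤ R / 3) (h₀₁ : ‖a₀₁‖ ≤ R / 3)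
    (h₁₁ : ‖a₁₁‖ ≤ R) :
    ‖g a₁₁ - g a₁₀ - g a₀₁ + g a₀₀‖
      ≤ L * ‖a₁₁ - a₁₀ - a₀₁ + a₀₀‖ + C * ‖a₁₀ - a₀₀‖ * ‖a₀₁ - a₀₀‖ := by
  have hR : 0 ≤ R := by linarith [norm_nonneg a₀₀]
  set w : F := a₀₀ + (a₁₀ - a₀₀) + (a₀₁ - a₀₀) with hw
  have hw' : w = a₁₀ + a₀₁ - a₀₀ := by rw [hw]; abel
  have hwR : ‖w‖ ≤ R := by
    rw [hw']
    calc ‖a₁₀ + a₀₁ - a₀₀‖ ≤ ‖a₁₀ + a₀₁‖ + ‖a₀₀‖ := norm_sub_le _ _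
      _ ≤ ‖a₁₀‖ + ‖a₀₁‖ + ‖a₀₀‖ := add_le_add (norm_add_le _ _) le_rfl
      _ ≤ R / 3 + R / 3 + R / 3 := by gcongr
      _ = R := by ring
  have h1 : ‖g a₁₁ - g w‖ ≤ L * ‖a₁₁ - a₁₀ - a₀₁ + a₀₀‖ := by
    have h := hL a₁₁ w h₁₁ hwR
    have he : a₁₁ - w = a₁₁ - a₁₀ - a₀₁ + a₀₀ := by rw [hw']; abel
    rwa [he] at h
  have h2 : ‖g w - g a₁₀ - g a₀₁ + g a₀₀‖ ≤ C * ‖a₁₀ - a₀₀‖ * ‖a₀₁ - a₀₀‖ := by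
    have e1 : a₀₀ + (a₁₀ - a₀₀) = a₁₀ := by abel
    have e2 : a₀₀ + (a₀₁ - a₀₀) = a₀₁ := by abel
    have h := hC a₀₀ (a₁₀ - a₀₀) (a₀₁ - a₀₀) (by linarith) (by rw [e1]; linarith)
      (by rw [e2]; linarith) hwR
    have e3 : a₀₀ + (a₁₀ - a₀₀) + (a₀₁ - a₀₀) = w := rfl
    rw [e3, e1, e2] at h
    exact h
  have hsplit : g a₁₁ - g a₁₀ - g a₀₁ + g a₀₀ = (g a₁₁ - g w) + (g w - g a₁₀ - g a₀₁ + g a₀₀) := by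
    abel
  rw [hsplit]
  exact (norm_add_le _ _).trans (add_le_add h1 h2)

/-! ## Composition -/

/-- **Composition.**  If `f` maps the `r`-ball into the `R/3`-ball, is `L_f`-Lipschitz with second
differences `≤ C_f‖u‖‖v‖` there, and `g` is `L_g`-Lipschitz with second differences `≤ C_g‖u‖‖v‖`
on the `R`-ball (`L_g, C_g ≥ 0`), then `g ∘ f` has second differences
`≤ (L_g C_f + C_g L_f²)‖u‖‖v‖` on the `r`-ball. -/
theorem norm_secondDiff_comp_le {f : E → F} {g : F → G} {r R Lf Cf Lg Cg : ℝ}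
    (hfR : ∀ x, ‖x‖ ≤ r → ‖f x‖ ≤ R / 3)
    (hfL : ∀ x y, ‖x‖ ≤ r → ‖y‖ ≤ r → ‖f x - f y‖ ≤ Lf * ‖x - y‖)
    (hfC : ∀ x u v, ‖x‖ ≤ r → ‖x + u‖ ≤ r → ‖x + v‖ ≤ r → ‖x + u + v‖ ≤ r →
      ‖f (x + u + v) - f (x + u) - f (x + v) + f x‖ ≤ Cf * ‖u‖ * ‖v‖)
    (hgL : ∀ a b : F, ‖a‖ ≤ R → ‖b‖ ≤ R → ‖g a - g b‖ ≤ Lg * ‖a - b‖)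
    (hgC : ∀ a u v : F, ‖a‖ ≤ R → ‖a + u‖ ≤ R → ‖a + v‖ ≤ R → ‖a + u + v‖ ≤ R →
      ‖g (a + u + v) - g (a + u) - g (a + v) + g a‖ ≤ Cg * ‖u‖ * ‖v‖)
    (hLg : 0 ≤ Lg) (hCg : 0 ≤ Cg)
    {x u v : E} (hx : ‖x‖ ≤ r) (hxu : ‖x + u‖ ≤ r) (hxv : ‖x + v‖ ≤ r) (hxuv : ‖x + u + v‖ ≤ r) :
    ‖g (f (x + u + v)) - g (f (x + u)) - g (f (x + v)) + g (f x)‖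
      ≤ (Lg * Cf + Cg * Lf ^ 2) * ‖u‖ * ‖v‖ := by
  have hR3 : ‖f (x + u + v)‖ ≤ R := by
    have h := hfR _ hxuv
    have : 0 ≤ R := by linarith [norm_nonneg (f (x + u + v))]
    linarith
  have hq := norm_secondDiff_quad_le hgL hgC (hfR _ hx) (hfR _ hxu) (hfR _ hxv) hR3
  have h1 : ‖f (x + u + v) - f (x + u) - f (x + v) + f x‖ ≤ Cf * ‖u‖ * ‖v‖ := hfC x u v hx hxu hxv hxuv
  have h2 : ‖f (x + u) - f x‖ ≤ Lf * ‖u‖ := by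
    have h := hfL (x + u) x hxu hx
    rwa [add_sub_cancel_left] at h
  have h3 : ‖f (x + v) - f x‖ ≤ Lf * ‖v‖ := by
    have h := hfL (x + v) x hxv hx
    rwa [add_sub_cancel_left] at h
  have hLf : 0 ≤ Lf * ‖u‖ := le_trans (norm_nonneg _) h2
  refine hq.trans ?_
  calc Lg * ‖f (x + u + v) - f (x + u) - f (x + v) + f x‖ + Cg * ‖f (x + u) - f x‖ * ‖f (x + v) - f x‖
      ≤ Lg * (Cf * ‖u‖ * ‖v‖) + Cg * (Lf * ‖u‖) * (Lf * ‖v‖) := by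
        refine add_le_add (mul_le_mul_of_nonneg_left h1 hLg) ?_
        exact mul_le_mul (mul_le_mul_of_nonneg_left h2 hCg) h3 (norm_nonneg _)
          (mul_nonneg hCg hLf)
    _ = (Lg * Cf + Cg * Lf ^ 2) * ‖u‖ * ‖v‖ := by ring

/-! ## Fixed points of parametrised contractions -/

section FixedPoint

variable {P H : Type*} [NormedAddCommGroup P] [NormedAddCommGroup H]
  {Φ : P → H → H} {S : Set P} {R θ L C : ℝ} {hp : P → H}

/-- **Lipschitz dependence of the fixed point on the parameter.**  If `Φ(p,·)` is a
`θ`-contraction of the `R`-ball (`θ < 1`) for `p ∈ S`, `‖Φ(p,h) − Φ(p',h)‖ ≤ L‖p − p'‖`, and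
`h(p) = Φ(p, h(p))` with `‖h(p)‖ ≤ R` for `p ∈ S`, then `‖h(p) − h(p')‖ ≤ (L/(1−θ))‖p − p'‖`. -/
theorem norm_fixedPoint_sub_le (hθ : θ < 1)
    (hcontr : ∀ p ∈ S, ∀ h h' : H, ‖h‖ ≤ R → ‖h'‖ ≤ R → ‖Φ p h - Φ p h'‖ ≤ θ * ‖h - h'‖)
    (hlipP : ∀ p ∈ S, ∀ p' ∈ S, ∀ h : H, ‖h‖ ≤ R → ‖Φ p h - Φ p' h‖ ≤ L * ‖p - p'‖)
    (hfix : ∀ p ∈ S, Φ p (hp p) = hp p) (hball : ∀ p ∈ S, ‖hp p‖ ≤ R)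
    {p p' : P} (hpS : p ∈ S) (hp'S : p' ∈ S) :
    ‖hp p - hp p'‖ ≤ L / (1 - θ) * ‖p - p'‖ := by
  have h1θ : 0 < 1 - θ := by linarith
  have hd : ‖hp p - hp p'‖ ≤ L * ‖p - p'‖ + θ * ‖hp p - hp p'‖ := by
    calc ‖hp p - hp p'‖ = ‖(Φ p (hp p) - Φ p' (hp p)) + (Φ p' (hp p) - Φ p' (hp p'))‖ := by
          rw [sub_add_sub_cancel, hfix p hpS, hfix p' hp'S]
      _ ≤ ‖Φ p (hp p) - Φ p' (hp p)‖ + ‖Φ p' (hp p) - Φ p' (hp p')‖ := norm_add_le _ _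
      _ ≤ L * ‖p - p'‖ + θ * ‖hp p - hp p'‖ :=
          add_le_add (hlipP p hpS p' hp'S _ (hball p hpS))
            (hcontr p' hp'S _ _ (hball p hpS) (hball p' hp'S))
  rw [div_mul_eq_mul_div, le_div_iff₀ h1θ]
  nlinarith

/-- **Second differences of the fixed point in the parameter.**  In the setting of
`norm_fixedPoint_sub_le` (`θ < 1`, `L ≥ 0`, fixed points in the `R/3`-ball), suppose `Φ` has
joint second differences
`‖Φ(p+u+v, h+y+z) − Φ(p+u, h+y) − Φ(p+v, h+z) + Φ(p, h)‖ ≤ C(‖u‖+‖y‖)(‖v‖+‖z‖)` (`C ≥ 0`) whenever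
the four parameters lie in `S` and the four points `h, h+y, h+z, h+y+z` in the `R`-ball.  Then for
`p, p+u, p+v, p+u+v ∈ S`:
`‖h(p+u+v) − h(p+u) − h(p+v) + h(p)‖ ≤ C(1 + L/(1−θ))²/(1−θ) · ‖u‖‖v‖`. -/
theorem norm_secondDiff_fixedPoint_le (hθ : θ < 1) (hL0 : 0 ≤ L) (hC0 : 0 ≤ C)
    (hcontr : ∀ p ∈ S, ∀ h h' : H, ‖h‖ ≤ R → ‖h'‖ ≤ R → ‖Φ p h - Φ p h'‖ ≤ θ * ‖h - h'‖)
    (hlipP : ∀ p ∈ S, ∀ p' ∈ S, ∀ h : H, ‖h‖ ≤ R → ‖Φ p h - Φ p' h‖ ≤ L * ‖p - p'‖)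
    (hC2 : ∀ p u v : P, p ∈ S → p + u ∈ S → p + v ∈ S → p + u + v ∈ S →
      ∀ h y z : H, ‖h‖ ≤ R → ‖h + y‖ ≤ R → ‖h + z‖ ≤ R → ‖h + y + z‖ ≤ R →
        ‖Φ (p + u + v) (h + y + z) - Φ (p + u) (h + y) - Φ (p + v) (h + z) + Φ p h‖
          ≤ C * (‖u‖ + ‖y‖) * (‖v‖ + ‖z‖))
    (hfix : ∀ p ∈ S, Φ p (hp p) = hp p) (hball : ∀ p ∈ S, ‖hp p‖ ≤ R / 3)
    {p u v : P} (h₀₀ : p ∈ S) (h₁₀ : p + u ∈ S) (h₀₁ : p + v ∈ S) (h₁₁ : p + u + v ∈ S) :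
    ‖hp (p + u + v) - hp (p + u) - hp (p + v) + hp p‖
      ≤ C * (1 + L / (1 - θ)) ^ 2 / (1 - θ) * ‖u‖ * ‖v‖ := by
  have h1θ : 0 < 1 - θ := by linarith
  have hR : 0 ≤ R := by linarith [norm_nonneg (hp p), hball p h₀₀]
  have hballR : ∀ q ∈ S, ‖hp q‖ ≤ R := fun q hq => (hball q hq).trans (by linarith)
  -- the four fixed points and the Lipschitz bounds on the first differences
  set y : H := hp (p + u) - hp p with hy
  set z : H := hp (p + v) - hp p with hz
  have hK : 0 ≤ L / (1 - θ) := div_nonneg hL0 h1θ.le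
  have hyb : ‖y‖ ≤ L / (1 - θ) * ‖u‖ := by
    have h := norm_fixedPoint_sub_le hθ hcontr hlipP hfix hballR h₁₀ h₀₀
    rwa [add_sub_cancel_left] at h
  have hzb : ‖z‖ ≤ L / (1 - θ) * ‖v‖ := by
    have h := norm_fixedPoint_sub_le hθ hcontr hlipP hfix hballR h₀₁ h₀₀
    rwa [add_sub_cancel_left] at h
  -- the auxiliary vertex
  set w : H := hp p + y + z with hw
  have e1 : hp p + y = hp (p + u) := by rw [hy]; abel
  have e2 : hp p + z = hp (p + v) := by rw [hz]; abel
  have hw' : w = hp (p + u) + hp (p + v) - hp p := by rw [hw, hy, hz]; abel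
  have hwR : ‖w‖ ≤ R := by
    rw [hw']
    calc ‖hp (p + u) + hp (p + v) - hp p‖ ≤ ‖hp (p + u) + hp (p + v)‖ + ‖hp p‖ := norm_sub_le _ _
      _ ≤ ‖hp (p + u)‖ + ‖hp (p + v)‖ + ‖hp p‖ := add_le_add (norm_add_le _ _) le_rfl
      _ ≤ R / 3 + R / 3 + R / 3 := by gcongr <;> exact hball _ ‹_›
      _ = R := by ring
  set D : H := hp (p + u + v) - hp (p + u) - hp (p + v) + hp p with hD
  have hDw : hp (p + u + v) - w = D := by rw [hw', hD]; abel
  -- `D = [Φ(p₁₁, h₁₁) − Φ(p₁₁, w)] + [joint second difference of Φ]`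
  have hsplit : D = (Φ (p + u + v) (hp (p + u + v)) - Φ (p + u + v) w) +
      (Φ (p + u + v) (hp p + y + z) - Φ (p + u) (hp p + y) - Φ (p + v) (hp p + z) + Φ p (hp p)) := by
    rw [← hw, e1, e2, hfix _ h₁₁, hfix _ h₁₀, hfix _ h₀₁, hfix _ h₀₀, hD]
    abel
  have hfirst : ‖Φ (p + u + v) (hp (p + u + v)) - Φ (p + u + v) w‖ ≤ θ * ‖D‖ := by
    have h := hcontr _ h₁₁ _ _ (hballR _ h₁₁) hwR
    rwa [hDw] at h
  have hsecond : ‖Φ (p + u + v) (hp p + y + z) - Φ (p + u) (hp p + y) - Φ (p + v) (hp p + z) + Φ p (hp p)‖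
      ≤ C * (‖u‖ + ‖y‖) * (‖v‖ + ‖z‖) :=
    hC2 p u v h₀₀ h₁₀ h₀₁ h₁₁ (hp p) y z (hballR _ h₀₀) (by rw [e1]; exact hballR _ h₁₀)
      (by rw [e2]; exact hballR _ h₀₁) hwR
  have hDle : ‖D‖ ≤ θ * ‖D‖ + C * (‖u‖ + ‖y‖) * (‖v‖ + ‖z‖) := by
    calc ‖D‖ = ‖(Φ (p + u + v) (hp (p + u + v)) - Φ (p + u + v) w) +
        (Φ (p + u + v) (hp p + y + z) - Φ (p + u) (hp p + y) - Φ (p + v) (hp p + z) + Φ p (hp p))‖ := by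
          rw [← hsplit]
      _ ≤ _ := (norm_add_le _ _).trans (add_le_add hfirst hsecond)
  -- `(‖u‖ + ‖y‖)(‖v‖ + ‖z‖) ≤ (1 + L/(1−θ))² ‖u‖‖v‖`
  have huy : ‖u‖ + ‖y‖ ≤ (1 + L / (1 - θ)) * ‖u‖ := by rw [add_mul, one_mul]; exact add_le_add le_rfl hyb
  have hvz : ‖v‖ + ‖z‖ ≤ (1 + L / (1 - θ)) * ‖v‖ := by rw [add_mul, one_mul]; exact add_le_add le_rfl hzb
  have hprod : C * (‖u‖ + ‖y‖) * (‖v‖ + ‖z‖) ≤ C * (1 + L / (1 - θ)) ^ 2 * ‖u‖ * ‖v‖ := by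
    calc C * (‖u‖ + ‖y‖) * (‖v‖ + ‖z‖) ≤ C * ((1 + L / (1 - θ)) * ‖u‖) * ((1 + L / (1 - θ)) * ‖v‖) := by
          refine mul_le_mul (mul_le_mul_of_nonneg_left huy hC0) hvz (by positivity) ?_
          exact mul_nonneg hC0 (by positivity)
      _ = C * (1 + L / (1 - θ)) ^ 2 * ‖u‖ * ‖v‖ := by ring
  have hfin : (1 - θ) * ‖D‖ ≤ C * (1 + L / (1 - θ)) ^ 2 * ‖u‖ * ‖v‖ := by nlinarith
  rw [show C * (1 + L / (1 - θ)) ^ 2 / (1 - θ) * ‖u‖ * ‖v‖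
      = C * (1 + L / (1 - θ)) ^ 2 * ‖u‖ * ‖v‖ / (1 - θ) by ring]
  rw [le_div_iff₀ h1θ, mul_comm]
  exact hfin

end FixedPoint

end Summit.HubbardSuperconductivity.HubbardSuperconductivity.Theorems.ComplexGFF

end
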